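import Summits.ValiantsHypothesis.ValiantsHypothesis.Theorems.GrenetZeonDualUnipotentThreeHalvesHeavyTopTowerLemmas
import Summits.ValiantsHypothesis.ValiantsHypothesis.Theorems.GrenetZeonDualUnipotentThreeHalvesHeavyTopCodimOneArithLevels
import Summits.ValiantsHypothesis.ValiantsHypothesis.Theorems.GrenetZeonDualUnipotentThreeHalvesHeavyTopCompositionBoundFiveSeven

/-!
# `GrenetZeon.DualUnipotentThreeHalves` (stmt-ValiantsHypothesis-24318), R2 heavy-top instrument — COROLLARY II port, step (L2-α):
# ALL BLOCKS OF SIZE ONE ⇒ TRIANGULARISABLE (the pattern space of an injective level function is conjugate to `𝔫_m`)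

Case (α) of the composition-chain route (crux note `CENSUS-THMC-UNIFORM-eng1g5.md` §8.5): if the composition chain of the conjugated space `V'` has
only levels of size one — i.e. the level function `lvl` is INJECTIVE — then `V'` lies in the pattern space `B_lvl = {A : A i j = 0 unless lvl j < lvl i}`
(block upper-triangular plus zero diagonal, the latter because a nilpotent matrix that is triangular for a total order has zero diagonal), `B_lvl` is a
nilpotent space (✓ `HeavyTopTowerLemmas.pow_apply_eq_zero_of_strictUpper_fun`) of dimension `#{lvl j < lvl i} = C(m,2)` (✓ `choose_two_eq_sum_levels`
with all `C(1,2) = 0`), so Gerstenhaber's EQUALITY case (✓ `deSeguinsPazzis2013_equality_holds`) conjugates `B_lvl`, hence `V'`, into `𝔫_m` — with no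
sorting permutation.

* `pow_apply_of_triangular`, `diag_eq_zero_of_isNilpotent_triangular` — triangular for an injective weight ⇒ `(A^k) i i = (A i i)^k`, so nilpotent ⇒ zero diagonal;
* `injective_of_card_fiber_le_one` — level sizes `≤ 1` ⇒ `lvl` injective;
* ★ `exists_unit_strictUpper_of_injective_levels` — `∃ Q, IsUnit Q ∧ ∀ A ∈ V', IsStrictUpper (Q * A * Q⁻¹)`.

Honest framing: linear algebra; nothing here proves or refutes `HeavyTopLaw`, 24318, S3b or 8062; `VP ≠ VNP` is NOT proved.  No definitions.
[val-idea-30 MEMO codim-one §0 COROLLARY II, triangularisable branch; cell val-heavytop-census, eng-1 g5]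
-/

noncomputable section

-- single-conjunct layout: Sub = Summit, duplicated namespace component intended
set_option linter.dupNamespace false

namespace Summit.ValiantsHypothesis.ValiantsHypothesis.Theorems.GrenetZeon.HeavyTopCodimOnePattern

open Matrix
open Summit.ValiantsHypothesis.ValiantsHypothesis.Theorems.GrenetZeon.HeavyTopTowerLemmas (pow_apply_eq_zero_of_strictUpper_fun)
open Summit.ValiantsHypothesis.ValiantsHypothesis.Theorems.GrenetZeon.HeavyTopCodimOneArith (choose_two_eq_sum_levels)
open Literature.LinearAlgebra.Matrix.GerstenhaberNilpotentSubspace (deSeguinsPazzis2013_equality_holds)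
open Literature.LinearAlgebra.Matrix (IsStrictUpper)

/-! ## Triangular for an injective weight: powers have the powered diagonal -/

/-- If `A i j = 0` whenever `f i < f j` for an INJECTIVE weight `f`, then the same holds for `A^k`, and `(A^k) i i = (A i i)^k`. [folklore] -/
theorem pow_apply_of_triangular {m : ℕ} (f : Fin m → ℕ) (hf : Function.Injective f) (A : Matrix (Fin m) (Fin m) ℂ)
    (hA : ∀ i j, f i < f j → A i j = 0) (k : ℕ) :
    (∀ i j, f i < f j → (A ^ k) i j = 0) ∧ ∀ i, (A ^ k) i i = A i i ^ k := by
  induction k with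
  | zero =>
    refine ⟨fun i j hij => ?_, fun i => ?_⟩
    · rw [pow_zero, Matrix.one_apply, if_neg]
      rintro rfl
      exact lt_irrefl _ hij
    · rw [pow_zero, pow_zero, Matrix.one_apply, if_pos rfl]
  | succ k ih =>
    refine ⟨fun i j hij => ?_, fun i => ?_⟩
    · rw [pow_succ, Matrix.mul_apply]
      refine Finset.sum_eq_zero fun l _ => ?_
      rcases lt_or_ge (f i) (f l) with hil | hil
      · rw [ih.1 i l hil, zero_mul]
      · rw [hA l j (by omega), mul_zero]
    · rw [pow_succ, Matrix.mul_apply, Finset.sum_eq_single i, ih.2 i, pow_succ]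
      · intro l _ hli
        rcases lt_or_gt_of_ne (fun h => hli (hf h)) with hil | hil
        · rw [hA l i hil, mul_zero]
        · rw [ih.1 i l hil, zero_mul]
      · intro h; exact absurd (Finset.mem_univ i) h

/-- A nilpotent matrix that is triangular for an injective weight has zero diagonal. [folklore] -/
theorem diag_eq_zero_of_isNilpotent_triangular {m : ℕ} (f : Fin m → ℕ) (hf : Function.Injective f) (A : Matrix (Fin m) (Fin m) ℂ)
    (hA : ∀ i j, f i < f j → A i j = 0) (hnil : IsNilpotent A) (i : Fin m) : A i i = 0 := by
  obtain ⟨k, hk⟩ := hnil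
  have h := (pow_apply_of_triangular f hf A hA k).2 i
  rw [hk, Matrix.zero_apply] at h
  exact pow_eq_zero_iff'.1 h.symm |>.1

/-- Level sizes `≤ 1` make the level function injective. -/
theorem injective_of_card_fiber_le_one {m L : ℕ} (lvl : Fin m → ℕ) (hlvl : ∀ i, lvl i < L)
    (hsize : ∀ t : Fin L, Fintype.card {i : Fin m // lvl i = (t : ℕ)} ≤ 1) : Function.Injective lvl := by
  intro i j hij
  have h : Fintype.card {k : Fin m // lvl k = lvl i} ≤ 1 := hsize ⟨lvl i, hlvl i⟩
  by_contra hne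
  have h2 : 2 ≤ Fintype.card {k : Fin m // lvl k = lvl i} := by
    have : Fintype.card ({x // x ∈ ({i, j} : Finset (Fin m))}) ≤ Fintype.card {k : Fin m // lvl k = lvl i} :=
      Fintype.card_le_of_injective (fun x => ⟨x.1, by
        rcases Finset.mem_insert.1 x.2 with h | h
        · rw [h]
        · rw [Finset.mem_singleton.1 h, hij]⟩) (fun x y hxy => Subtype.ext (by simpa using congrArg Subtype.val hxy))
    rw [Fintype.card_coe, Finset.card_pair hne] at this
    exact this
  omega

/-! ## ★ Case (α): all blocks of size one ⇒ a conjugate inside `𝔫_m` -/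

/-- ★ **All levels of size one ⇒ triangularisable.**  If `lvl` is injective (values `< L`) and `V'` is nilpotent and block upper-triangular for `lvl`
(`A i j = 0` for `lvl i < lvl j`), then some unit `Q` conjugates every member of `V'` into the strictly upper triangular matrices.
[val-idea-30 MEMO codim-one, COROLLARY II case (α); Gerstenhaber equality ✓ `deSeguinsPazzis2013_equality_holds`] -/
theorem exists_unit_strictUpper_of_injective_levels {m L : ℕ} (lvl : Fin m → ℕ) (hlvl : ∀ i, lvl i < L) (hinj : Function.Injective lvl)
    (V' : Submodule ℂ (Matrix (Fin m) (Fin m) ℂ)) (hnil : ∀ A ∈ V', IsNilpotent A)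
    (hblock : ∀ A ∈ V', ∀ i j, lvl i < lvl j → A i j = 0) :
    ∃ Q : Matrix (Fin m) (Fin m) ℂ, IsUnit Q ∧ ∀ A ∈ V', IsStrictUpper (Q * A * Q⁻¹) := by
  classical
  -- the pattern space `B = {A : A i j = 0 unless lvl j < lvl i}`
  let B : Submodule ℂ (Matrix (Fin m) (Fin m) ℂ) :=
    { carrier := {A | ∀ i j, lvl i ≤ lvl j → A i j = 0}
      add_mem' := fun {A C} hA hC i j hij => by
        simp only [Set.mem_setOf_eq] at hA hC
        rw [Matrix.add_apply, hA i j hij, hC i j hij, add_zero]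
      zero_mem' := fun _ _ _ => rfl
      smul_mem' := fun c A hA i j hij => by
        simp only [Set.mem_setOf_eq] at hA
        rw [Matrix.smul_apply, hA i j hij, smul_zero] }
  have hmemB : ∀ A, A ∈ B ↔ ∀ i j, lvl i ≤ lvl j → A i j = 0 := fun A => Iff.rfl
  -- `V' ≤ B`
  have hV'B : ∀ A ∈ V', A ∈ B := by
    intro A hA
    rw [hmemB]
    intro i j hij
    rcases lt_or_eq_of_le hij with hlt | heq
    · exact hblock A hA i j hlt
    · rw [← hinj heq]
      exact diag_eq_zero_of_isNilpotent_triangular lvl hinj A (hblock A hA) (hnil A hA) i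
  -- `B` is nilpotent
  have hBnil : ∀ A ∈ B, IsNilpotent A := by
    intro A hA
    rw [hmemB] at hA
    refine ⟨L + 1, ?_⟩
    ext i j
    rw [Matrix.zero_apply]
    refine pow_apply_eq_zero_of_strictUpper_fun (fun k => L - lvl k) A (fun k l hkl => hA k l ?_) (L + 1) i j ?_
    · have := hlvl k; have := hlvl l; omega
    · have := hlvl j; omega
  -- `dim B = #{lvl j < lvl i} = C(m,2)`
  have hBdim : Module.finrank ℂ B = m.choose 2 := by
    let e : B ≃ₗ[ℂ] ({x : Fin m × Fin m // lvl x.2 < lvl x.1} → ℂ) :=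
      { toFun := fun A x => (A : Matrix (Fin m) (Fin m) ℂ) x.1.1 x.1.2
        invFun := fun g => ⟨Matrix.of fun i j => if h : lvl j < lvl i then g ⟨(i, j), h⟩ else 0, by
          rw [hmemB]
          intro i j hij
          rw [Matrix.of_apply, dif_neg (not_lt.2 hij)]⟩
        map_add' := fun A C => by funext x; rfl
        map_smul' := fun c A => by funext x; rfl
        left_inv := fun A => by
          apply Subtype.ext
          ext i j
          simp only [Matrix.of_apply]
          by_cases h : lvl j < lvl i
          · rw [dif_pos h]
          · rw [dif_neg h]
            exact ((hmemB _).1 A.2 i j (not_lt.1 h)).symm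
        right_inv := fun g => by
          funext x
          simp only [Matrix.of_apply]
          rw [dif_pos x.2] }
    rw [e.finrank_eq, Module.finrank_fintype_fun_eq_card]
    have harith := choose_two_eq_sum_levels lvl hlvl
    have hzero : ∑ t ∈ Finset.range L, (Fintype.card {i : Fin m // lvl i = t}).choose 2 = 0 := by
      refine Finset.sum_eq_zero fun t _ => Nat.choose_eq_zero_of_lt ?_
      have : Fintype.card {i : Fin m // lvl i = t} ≤ 1 :=
        Fintype.card_le_one_iff_subsingleton.2 ⟨fun a b => Subtype.ext (hinj (a.2.trans b.2.symm))⟩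
      omega
    omega
  obtain ⟨Q, hQ, hQB⟩ := deSeguinsPazzis2013_equality_holds ℂ m B hBnil hBdim
  exact ⟨Q, hQ, fun A hA => (hQB A).1 (hV'B A hA)⟩

end Summit.ValiantsHypothesis.ValiantsHypothesis.Theorems.GrenetZeon.HeavyTopCodimOnePattern

end
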